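/-
Copyright: the b2b-balaban cell (near-miss cell 7), T⁴-continuum fan-out; row NE7b ROUND-2 swarm, seat
t4-ne7b-formalise-leaf-05 (row S6e of `t4/b2b-balaban-t4-ne7b-p1/LEAVES-NE7b.md`, RULING R-OWNER-22-1).
Released under the licence of the surrounding project.
-/
import Summits.QuantumFields.BalabanUV.T4Continuum.Support.CountThresholdExit
import Summits.QuantumFields.BalabanUV.T4Continuum.Support.HistoryConsistent

/-!
# Row NE7b, leaf S6e: the zone surcharge ABSORBED against the TH exit (tree slots, tagged genealogies)

Summits-side support leaf of the T⁴-continuum cell (rung (B)+1 on a FINITE torus only; NOT infinite volume, NOT the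
mass gap, NOT the Clay statement; NOT a proof of the spine estimate NE7b).  Row S6e of the owner's RULING R-OWNER-22-1
(claim table `t4/b2b-balaban-t4-ne7b-p1/LEAVES-NE7b.md`): the COUNT assembly targets the TH exit
`CountThresholdExit.relWeightBound_lateMergers_of_irThreshold` (slots `(j, z, shape tree)` over TAGGED genealogies
`G′ : Gen ε`, shape map `sh : ε → PEv`).  [folklore] real arithmetic and finite bookkeeping over the lineage's OWN carrier;
nothing is quoted from print, nothing printed is asserted, no `[cite:]` tag, no `def … : Prop` fact (c1); constants
SYMBOLIC (c2∕c6).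

WHY.  `hlabTH` allows per tree slot the price `Δ·Λ′^{partnerAges}·e^{−credits∘sh}·e^{+lifeCost}` with ONE global `Δ ≥ 1`;
the reading (GM) prices a live structure by that raw factor TIMES the zone-admissible placement count
`Kz^{#merges}·∏ Q(wcnt,σ,step)^p·Λ′^{partnerAges}` of its genealogy (row S6, on the FLAT genealogy `gmap sh G′`).  As on the
Z-route (`PartnerMultiplicityZ.zone_surcharge_le`, `PartnerMultiplicityFloor`, `CountThresholdUniform.relWeightBoundG∕Z…`)
the factor is class-linear and is paid by lowering `a` by `θ∕P²` against the infrared floor `P`; here the surcharge is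
read on the TAGGED births (`b ∈ births G′` weighted `(sh b).fat + 1`, with multiplicity) and the credits through `sh`.

WHAT.  §1 through the shape: `consistentTH_lowerA_iff`, `costT_lowerA`, `births_subset_filterTH`,
`step_le_of_consistentTH`, the tagged credit lemmas `creditsT_lowerA_add_le_floor` ∕ `creditsT_lowerA_anti` ∕
`exp_mul_fatSumT_mul_exp_neg_credits_le_floor`.  §2 **`relWeightBound_lateMergersG_of_irThreshold`**: the TH exit with the
CLASS-LINEAR binder `hlabGTH` (`y ≤ Δ·exp(θ·Σ_{b ∈ births G′}((sh b).fat+1))·Λ′^{partnerAges}·raw`), NO room condition,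
every horizon `D`, at the NAMED threshold `irThresholdGTH sh C θ L r β₀ D` (`irThresholdTH` at `lowerA C (a∕2)` ⊔ `1` ⊔
`2θ(1+β₀)²∕(a·A₀²)`); conclusion = the TH exit's VERBATIM.  §3 **`relWeightBound_lateMergersZ_of_irThreshold`**: the TH exit
at `D = 0` (the ruling's target) with the ZONE binder `hlabZTH` — the full (GM) multiplicity on `gmap sh G′` (the form
row S6 delivers) times the tagged raw factor — under the DISPLAYED shape-genericity `Set.InjOn sh ↑G′.events` of the
member (which makes `gmap sh G′` well formed, `HistoryConsistent.wf_relabel_of_injOn`); threshold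
`irThresholdZTH := irThresholdGTH … (zoneRate Kz p σ ε θ) … 0`, placement rate `Λ′e^{ε}`.  §4 sanity.

NOT DONE HERE.  (i) The Z→G step WITHOUT shape-genericity is FALSE for repeated birth shapes (finding F-leaf05-2: `m`
equal-shape births at one step merged at the next cost `p·m·log m` against an `O(m)` budget).  Under births-genericity
`Set.InjOn sh ↑(births G′)` it is `HistoryCrowdingTagged.zone_surchargeS_le` (part 2, binder read on the TAGGED tree);
without it only a symmetrised sibling count (row S6g) can pay.  (ii) Nothing of H3 ∕ (B) ∕ BetaPertH.  NE7b NOT proved.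

HONEST DEPENDENCY (cell): continuum YM on T⁴ ⇐ BetaPertH ∧ nine spine estimates (0/9 proved); BetaPertH ⇐ (D1) ∧ (D4)
∧ CAP+tail; G-an2-4 gates asym, D1 and NE2/3/4.  This file changes none of it.
-/

open Finset
open Literature.MathematicalPhysics.QuantumFieldTheory.Balaban1983to89
open T4PersistenceDictionary T4PersistentHistoryCount T4BankedInduction T4PrintedShapeBanking T4PartnerMultiplicity
open T4WeightBudget T4GlobalDenominator T4LiveClassFibration T4LiveStructureGas T4LiveGasToTerms T4RecordPriceSeam
open T4BranchingRecordsGas T4TaggedShapeBanking T4CanonicalMenus T4CountHorizon T4MatchingClosureSocket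
open Summit.QuantumFields.BalabanUV.T4Continuum
open PlacementBatch PlacementSkeleton PartnerMultiplicityF PartnerMultiplicityG PartnerMultiplicityZ
open PartnerMultiplicityFloor PartnerMultiplicityThreshold Crowding CountThresholdUniform CountThresholdExit
open LateMergers ZoneSkeleton HistoryConsistent

namespace Summit.QuantumFields.BalabanUV.T4Continuum.HistoryZoneSurcharge

noncomputable section

/-! ## §1 Through the shape map: what does not see `a`; births; steps; the tagged credit lemmas -/

section Tagged

variable {ε : Type*} [DecidableEq ε] (sh : ε → PEv)

omit [DecidableEq ε] in
/-- `ConsistentTH` reads only `n₁` of the constants: late-merger consistency at `lowerA C θ` is the one at `C`.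
[folklore] -/
theorem consistentTH_lowerA_iff (C : T4PrintedShapeBanking.Consts) (θ : ℝ) (K : ℕ) (R : ℕ → ℕ) (D : ℕ) :
    ∀ G : Gen ε, ConsistentTH sh (lowerA C θ) K R D G ↔ ConsistentTH sh C K R D G
  | Gen.born _ _ => Iff.rfl
  | Gen.renew G e h => by
      simp only [ConsistentTH, consistentTH_lowerA_iff C θ K R D G, lowerA_n₁]
  | Gen.merge X Y e => by
      simp only [ConsistentTH, consistentTH_lowerA_iff C θ K R D X, consistentTH_lowerA_iff C θ K R D Y, lowerA_n₁]

/-- the booked per-step cost through the shape does not read the quadratic birth constant [folklore] -/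
theorem costT_lowerA (C : T4PrintedShapeBanking.Consts) (θ : ℝ) (K : ℕ) (R : ℕ → ℕ) :
    costT sh (lowerA C θ) K R = costT sh C K R := rfl

variable {sh}

/-- the births of a consistent tagged genealogy have shape kind `0` (any horizon `D`) [folklore] -/
theorem kind_eq_zero_of_mem_birthsTH {C : T4PrintedShapeBanking.Consts} {K : ℕ} {R : ℕ → ℕ} {D : ℕ} :
    ∀ {G : Gen ε}, ConsistentTH sh C K R D G → ∀ b ∈ births G, (sh b).kind = 0
  | Gen.born b j, hc, b', hb' => by
      simp only [births_born, mem_singleton] at hb'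
      exact hb' ▸ hc.1
  | Gen.renew G e h, hc, b', hb' => kind_eq_zero_of_mem_birthsTH (G := G) hc.1 b' hb'
  | Gen.merge X Y e, hc, b', hb' => by
      rcases mem_union.1 hb' with h | h
      · exact kind_eq_zero_of_mem_birthsTH hc.1 b' h
      · exact kind_eq_zero_of_mem_birthsTH hc.2.1 b' h

/-- **THE BIRTHS OF A CONSISTENT TAGGED GENEALOGY ARE KIND-`0` EVENTS.** [folklore] -/
theorem births_subset_filterTH {C : T4PrintedShapeBanking.Consts} {K : ℕ} {R : ℕ → ℕ} {D : ℕ} {G : Gen ε}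
    (hc : ConsistentTH sh C K R D G) : births G ⊆ G.events.filter fun e => (sh e).kind = 0 := fun b hb =>
  mem_filter.2 ⟨births_subset_events G hb, kind_eq_zero_of_mem_birthsTH hc b hb⟩

/-- **EVERY EVENT OF A CONSISTENT TAGGED GENEALOGY HAS STEP `≤ K`.** [folklore] -/
theorem step_le_of_consistentTH {C : T4PrintedShapeBanking.Consts} {K : ℕ} {R : ℕ → ℕ} {D : ℕ} :
    ∀ {G : Gen ε}, ConsistentTH sh C K R D G → ∀ e ∈ G.events, (sh e).step ≤ K
  | Gen.born b j, hc, e, he => by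
      obtain ⟨-, hs, hj⟩ := hc
      rw [Gen.events_born, mem_singleton] at he; subst he; omega
  | Gen.renew G e h, hc, x, hx => by
      obtain ⟨hG, -, hs, -, hK⟩ := hc
      rw [Gen.events_renew, mem_insert] at hx
      rcases hx with rfl | hx
      · omega
      · exact step_le_of_consistentTH hG x hx
  | Gen.merge X Y e, hc, x, hx => by
      obtain ⟨hX, hY, -, -, -, -, -, hK⟩ := hc
      rw [Gen.events_merge, mem_insert, mem_union] at hx
      rcases hx with rfl | hx | hx
      · exact hK
      · exact step_le_of_consistentTH hX x hx
      · exact step_le_of_consistentTH hY x hx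

/-- **TAGGED CREDITS, LOWERING `a` BY `θ∕P²` AGAINST A FLOOR `0 < P ≤ p₀(g_s)`** (kind-`0` events):
`credits (credit (lowerA C (θ∕P²)) g ∘ sh) G + θ·Σ_{kind-0 events}((sh e).fat + 1) ≤ credits (credit C g ∘ sh) G`. [folklore] -/
theorem creditsT_lowerA_add_le_floor {C : T4PrintedShapeBanking.Consts} {g : ℕ → ℝ} {θ P : ℝ} (hθ : 0 ≤ θ)
    (hP : 0 < P) (G : Gen ε) (hPe : ∀ e ∈ G.events, (sh e).kind = 0 → P ≤ p0Profile C.A₀ C.p₀ (g (sh e).step)) :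
    credits (credit (lowerA C (θ / P ^ 2)) g ∘ sh) G +
        θ * ∑ e ∈ G.events.filter (fun e => (sh e).kind = 0), ((((sh e).fat : ℕ) : ℝ) + 1) ≤
      credits (credit C g ∘ sh) G := by
  unfold credits
  rw [sum_filter, mul_sum, ← sum_add_distrib]
  refine sum_le_sum fun e he => ?_
  simp only [Function.comp_apply]
  by_cases h : (sh e).kind = 0
  · rw [if_pos h]; exact credit_lowerA_add_le_floor hθ hP h (hPe e he h)
  · rw [if_neg h, mul_zero, add_zero, credit_lowerA_of_kind_ne C g _ h]

/-- tagged credits: a larger lowering gives smaller credits [folklore] -/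
theorem creditsT_lowerA_anti (C : T4PrintedShapeBanking.Consts) (g : ℕ → ℝ) {t₁ t₂ : ℝ} (h : t₁ ≤ t₂) (G : Gen ε) :
    credits (credit (lowerA C t₂) g ∘ sh) G ≤ credits (credit (lowerA C t₁) g ∘ sh) G :=
  sum_le_sum fun e _ => credit_lowerA_anti C g h (sh e)

/-- **THE CLASS-LINEAR SURCHARGE ON THE TAGGED BIRTHS IS PAID BY THE TAGGED CREDITS, WITH A FLOOR** (any horizon `D`):
`exp(θ·Σ_{b ∈ births G}((sh b).fat+1))·e^{−credits (credit C g ∘ sh) G} ≤ e^{−credits (credit (lowerA C (θ∕P²)) g ∘ sh) G}`.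
[folklore] -/
theorem exp_mul_fatSumT_mul_exp_neg_credits_le_floor {C : T4PrintedShapeBanking.Consts} {K : ℕ} {R : ℕ → ℕ} {D : ℕ}
    {g : ℕ → ℝ} {θ P : ℝ} (hθ : 0 ≤ θ) (hP : 0 < P) {G : Gen ε} (hc : ConsistentTH sh C K R D G)
    (hPe : ∀ e ∈ G.events, (sh e).kind = 0 → P ≤ p0Profile C.A₀ C.p₀ (g (sh e).step)) :
    Real.exp (θ * ∑ b ∈ births G, ((((sh b).fat : ℕ) : ℝ) + 1)) * Real.exp (-credits (credit C g ∘ sh) G) ≤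
      Real.exp (-credits (credit (lowerA C (θ / P ^ 2)) g ∘ sh) G) := by
  have h1 := creditsT_lowerA_add_le_floor (sh := sh) hθ hP G hPe
  have h2 : ∑ b ∈ births G, ((((sh b).fat : ℕ) : ℝ) + 1) ≤
      ∑ e ∈ G.events.filter (fun e => (sh e).kind = 0), ((((sh e).fat : ℕ) : ℝ) + 1) :=
    sum_le_sum_of_subset_of_nonneg (births_subset_filterTH hc) fun _ _ _ => by positivity
  rw [← Real.exp_add, Real.exp_le_exp]
  nlinarith [mul_le_mul_of_nonneg_left h2 hθ]

end Tagged

/-! ## §2 The TH exit with the class-linear binder (`hlabGTH`), threshold named, every horizon `D` -/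

/-- **THE CLASS-LINEAR TH THRESHOLD, NAMED**: the late-merger `Banking` threshold at HALF the quadratic constant,
enlarged to `≥ 1` and `≥ 2θ(1+β₀)²∕(a·A₀²)`.  A function of `(sh, C, θ, L, r, β₀, D)` only. [folklore] -/
def irThresholdGTH {ε : Type*} [DecidableEq ε] (sh : ε → PEv) (C : T4PrintedShapeBanking.Consts) (θ : ℝ)
    (L r : ℕ) (β₀ : ℝ) (D : ℕ) : ℝ :=
  max (irThresholdTH sh (lowerA C (C.a / 2)) L r β₀ D) (max 1 (2 * θ * (1 + β₀) ^ 2 / (C.a * C.A₀ ^ 2)))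

/-- **THE ZONE TH THRESHOLD, NAMED** (horizon `0`): the class-linear one at `θ := zoneRate Kz p σ ε θ`. [folklore] -/
def irThresholdZTH {ε : Type*} [DecidableEq ε] (sh : ε → PEv) (C : T4PrintedShapeBanking.Consts)
    (Kz p σ ε θ : ℝ) (L r : ℕ) (β₀ : ℝ) : ℝ :=
  irThresholdGTH sh C (zoneRate Kz p σ ε θ) L r β₀ 0

/-- the class-linear TH threshold dominates the half-constant `Banking` threshold [folklore] -/
theorem irThresholdTH_le_irThresholdGTH {ε : Type*} [DecidableEq ε] (sh : ε → PEv) (C : T4PrintedShapeBanking.Consts)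
    (θ : ℝ) (L r : ℕ) (β₀ : ℝ) (D : ℕ) :
    irThresholdTH sh (lowerA C (C.a / 2)) L r β₀ D ≤ irThresholdGTH sh C θ L r β₀ D := le_max_left _ _

/-- it is at least `1` [folklore] -/
theorem one_le_irThresholdGTH {ε : Type*} [DecidableEq ε] (sh : ε → PEv) (C : T4PrintedShapeBanking.Consts) (θ : ℝ)
    (L r : ℕ) (β₀ : ℝ) (D : ℕ) : 1 ≤ irThresholdGTH sh C θ L r β₀ D := (le_max_left _ _).trans (le_max_right _ _)

/-- it dominates the half-room ratio [folklore] -/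
theorem room_le_irThresholdGTH {ε : Type*} [DecidableEq ε] (sh : ε → PEv) (C : T4PrintedShapeBanking.Consts) (θ : ℝ)
    (L r : ℕ) (β₀ : ℝ) (D : ℕ) : 2 * θ * (1 + β₀) ^ 2 / (C.a * C.A₀ ^ 2) ≤ irThresholdGTH sh C θ L r β₀ D :=
  (le_max_right _ _).trans (le_max_right _ _)

section EndToEnd

variable {ε : Type*} [DecidableEq ε]
variable {γ κ ι : Type*} [DecidableEq γ] [DecidableEq κ] {l₀ : ℝ} {K₀ : ℕ} {π : ℕ → ι → κ} {T : ℕ → Finset ι}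
  {A A' : ℕ → ℝ → ι → ℝ} {Bad' : ℕ → ℝ → Finset κ} {dead dead' : ℕ → ℝ → ι → ℝ} {F Rf F' Rf' : ℕ → κ → ℝ}
  {nlow nup mlow mup : ℕ → ℝ → ℝ} {Cn : ℝ}

/-- **THE TH EXIT WITH THE CLASS-LINEAR BINDER `hlabGTH`, NO ROOM CONDITION, THRESHOLD NAMED.**
`CountThresholdExit.relWeightBound_lateMergers_of_irThreshold` VERBATIM except: a free rate `θ ≥ 0`; the infrared smallness
at `irThresholdGTH sh C θ L r β₀ D`; the slot price may carry the extra factor `exp(θ·Σ_{b ∈ births G′}((sh b).fat+1))`.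
Proof: the TH exit at `lowerA C (a∕2)`, the surcharge paid by lowering `a` by `θ∕P²` against the infrared floor
`P = A₀·x^{p₀}∕(1+β₀)` of the run (`floor_of_ir`, `half_room_of_threshold`, `θ∕P² ≤ a∕2`). [folklore] -/
theorem relWeightBound_lateMergersG_of_irThreshold (sh : ε → PEv) {C : T4PrintedShapeBanking.Consts} {L r : ℕ}
    {β₀ : ℝ} (h : ThresholdOK C L r β₀) (hμ₀ : 0 < C.μ) {θ : ℝ} (hθ : 0 ≤ θ)
    (Cell : ℕ → ℕ → Finset γ) {V Λ : ℝ} (hV : 0 ≤ V) (hΛ : 0 < Λ)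
    (hcell : ∀ K a, ((Cell K a).card : ℝ) ≤ V * Λ ^ a) (Dcap Ncap : ℕ → ℕ)
    (jstar : ℕ → ℕ) (hj : ∀ K, jstar K ≤ K) {c : ℝ} (hc : 0 < c)
    (hfrac : ∀ K : ℕ, c * K ≤ ((K - jstar K : ℕ) : ℝ)) (D : ℕ) {Δ : ℝ} (hΔ : 1 ≤ Δ)
    (hA : Regeneration l₀ π T A Bad' dead F Rf nlow nup Cn K₀)
    (hA' : Regeneration l₀ π T A' Bad' dead' F' Rf' mlow mup Cn K₀) (hCn : 0 ≤ Cn)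
    (R : ℕ → ℕ → ℕ) (g : ℕ → ℕ → ℝ) (β' : ℕ → ℝ)
    (h27 : ∀ K, K₀ ≤ K → B14.FlowIneq27 (g K) (β' K) β₀ C.p₀ K)
    (h29 : ∀ K, K₀ ≤ K → B14FlowStep.FlowIneq29 (R K) (g K) L (β' K) β₀ K)
    (hR : ∀ K, K₀ ≤ K → ∀ s, s ≤ K → B14.IsRj L r (g K s) (R K s))
    (hx1 : ∀ K, K₀ ≤ K → ∀ s, s ≤ K → 1 ≤ Real.log ((g K s) ^ 2)⁻¹)
    (hir : ∀ K, K₀ ≤ K → irThresholdGTH sh C θ L r β₀ D ≤ Real.log ((g K K) ^ 2)⁻¹)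
    (hP : ∀ K s, 0 ≤ p0Profile C.A₀ C.p₀ (g K s))
    {ηplus : ℝ} (hηplus : 0 ≤ ηplus) (hr : Λ * Real.exp (ηplus - C.κ₁) < 1)
    {Λ' : ℝ} (hΛ0 : 0 ≤ Λ') (h1 : Λ' * Real.exp (-C.κ₁) * Real.exp ηplus < 1)
    (hx : (Real.exp (-C.E₀) + Real.exp (-C.E₀) * birthMass C *
          (Λ' * Real.exp (-C.κ₁) / (1 - Λ' * Real.exp (-C.κ₁) * Real.exp ηplus))) * Real.exp ηplus ≤
        Real.exp ηplus - 1)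
    (y : ℕ → ℕ → γ → Gen PEv → ℝ)
    (hy0 : ∀ K, ∀ j ≤ K, ∀ z ∈ Cell K (K - j), ∀ G ∈ canonFam Dcap Ncap K j, 0 ≤ y K j z G)
    (hlabGTH : ∀ K, K₀ ≤ K → ∀ j ≤ K, ∀ z ∈ Cell K (K - j), ∀ G ∈ canonFam Dcap Ncap K j,
      y K j z G ≤ 0 ∨ ∃ G' : Gen ε, ConsistentTH sh C K (R K) D G' ∧ FreshT G' ∧
        K - D < G'.reach (dictWT sh (R K) C.n₁) ∧ relabel (shape ∘ sh) G' = G ∧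
        y K j z G ≤ Δ * (Real.exp (θ * ∑ b ∈ births G', ((((sh b).fat : ℕ) : ℝ) + 1)) *
          (Λ' ^ partnerAges (PEv.step ∘ sh) G' * (Real.exp (-credits (credit C (g K) ∘ sh) G') *
            Real.exp (lifeCost (padW (dictWT sh (R K) C.n₁) D) (costT sh C K (R K)) G')))))
    (str : ℕ → κ → Finset (BSlot γ PEv))
    (hinj : ∀ K t, |t| ≤ l₀ → K₀ ≤ K → Set.InjOn (str K) (Bad' K t))
    (hstr : ∀ K t, |t| ≤ l₀ → K₀ ≤ K → ∀ c ∈ Bad' K t,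
      str K c ⊆ bliveSlots Cell (canonFam Dcap Ncap) K ∧
        ∃ o ∈ boldSlots Cell (canonFam Dcap Ncap) jstar K, o ∈ str K c)
    (hF : ∀ K t, |t| ≤ l₀ → K₀ ≤ K → ∀ c ∈ Bad' K t, F K c * Rf K c ≤ famWeight (bslotPrice (y K)) (str K c))
    (hF' : ∀ K t, |t| ≤ l₀ → K₀ ≤ K → ∀ c ∈ Bad' K t, F' K c * Rf' K c ≤ famWeight (bslotPrice (y K)) (str K c)) :
    ∃ K₁, K₀ ≤ K₁ ∧ RelWeightBound l₀ T A A' (fun K t => if K₁ ≤ K then badOfClass π T Bad' K t else ∅)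
      (Set.indicator {K | K₁ ≤ K}
        (fun K => Cn * recordsBudget (Δ * Real.exp (C.κ₁ * (D : ℝ)) * birthMass C) C.κ₁ V Λ ηplus jstar K)) := by
  -- the TH exit at HALF the quadratic constant, with its NAMED threshold
  set C' := lowerA C (C.a / 2) with hC'def
  have h' : ThresholdOK C' L r β₀ := thresholdOK_half h
  have ha : 0 < C.a := h.a_pos
  have hA₀ : 0 < C.A₀ := h.A₀_pos
  have hβ : 0 ≤ β₀ := h.β₀_nonneg
  have hp1 : 1 ≤ C.p₀ := by
    have : r * (C.q' + 1) < C.p₀ := h.rq_lt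
    omega
  have hir' : ∀ K, K₀ ≤ K → irThresholdTH sh C' L r β₀ D ≤ Real.log ((g K K) ^ 2)⁻¹ := fun K hK =>
    (irThresholdTH_le_irThresholdGTH sh C θ L r β₀ D).trans (hir K hK)
  have hlabTH : ∀ K, K₀ ≤ K → ∀ j ≤ K, ∀ z ∈ Cell K (K - j), ∀ G ∈ canonFam Dcap Ncap K j,
      y K j z G ≤ 0 ∨ ∃ G' : Gen ε, ConsistentTH sh C' K (R K) D G' ∧ FreshT G' ∧
        K - D < G'.reach (dictWT sh (R K) C'.n₁) ∧ relabel (shape ∘ sh) G' = G ∧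
        y K j z G ≤ Δ * (Λ' ^ partnerAges (PEv.step ∘ sh) G' * (Real.exp (-credits (credit C' (g K) ∘ sh) G') *
          Real.exp (lifeCost (padW (dictWT sh (R K) C'.n₁) D) (costT sh C' K (R K)) G'))) := by
    intro K hK j hjK z hz G hG
    rcases hlabGTH K hK j hjK z hz G hG with h0 | ⟨G', hcG, hfG, hKr, hsh, hy⟩
    · exact Or.inl h0
    · refine Or.inr ⟨G', (consistentTH_lowerA_iff sh C (C.a / 2) K (R K) D G').2 hcG, hfG, hKr, hsh, hy.trans ?_⟩
      -- the infrared floor at this cutoff and the half-room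
      have hxK1 : 1 ≤ Real.log ((g K K) ^ 2)⁻¹ := (one_le_irThresholdGTH sh C θ L r β₀ D).trans (hir K hK)
      have hxK2 : 2 * θ * (1 + β₀) ^ 2 / (C.a * C.A₀ ^ 2) ≤ Real.log ((g K K) ^ 2)⁻¹ :=
        (room_le_irThresholdGTH sh C θ L r β₀ D).trans (hir K hK)
      obtain ⟨hPpos, hroom⟩ := half_room_of_threshold ha hA₀ hβ hp1 hxK1 hxK2
      set P := C.A₀ * Real.log ((g K K) ^ 2)⁻¹ ^ C.p₀ / (1 + β₀) with hPdef
      have hPe : ∀ e ∈ G'.events, (sh e).kind = 0 → P ≤ p0Profile C.A₀ C.p₀ (g K (sh e).step) :=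
        fun e he _ => by
          have hfl := floor_of_ir (h27 K hK) hβ hA₀.le (by linarith) (step_le_of_consistentTH hcG e he)
          simpa [p0Profile, hPdef] using hfl
      have key := exp_mul_fatSumT_mul_exp_neg_credits_le_floor (sh := sh) (g := g K) hθ hPpos hcG hPe
      -- antitonicity: lowering by `θ∕P² ≤ a∕2` leaves at least the credits of `C'`
      have hanti : Real.exp (-credits (credit (lowerA C (θ / P ^ 2)) (g K) ∘ sh) G') ≤
          Real.exp (-credits (credit C' (g K) ∘ sh) G') := by
        rw [Real.exp_le_exp, neg_le_neg_iff, hC'def]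
        exact creditsT_lowerA_anti (sh := sh) C (g K) hroom G'
      have hΔ0 : 0 ≤ Δ := zero_le_one.trans hΔ
      have hcost : lifeCost (padW (dictWT sh (R K) C.n₁) D) (costT sh C K (R K)) G' =
          lifeCost (padW (dictWT sh (R K) C'.n₁) D) (costT sh C' K (R K)) G' := by
        rw [hC'def, costT_lowerA, lowerA_n₁]
      rw [hcost]
      set Xl := Real.exp (lifeCost (padW (dictWT sh (R K) C'.n₁) D) (costT sh C' K (R K)) G')
      set Fb := ∑ b ∈ births G', ((((sh b).fat : ℕ) : ℝ) + 1)
      have hmid := key.trans hanti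
      calc Δ * (Real.exp (θ * Fb) * (Λ' ^ partnerAges (PEv.step ∘ sh) G' *
              (Real.exp (-credits (credit C (g K) ∘ sh) G') * Xl)))
          = Δ * (Λ' ^ partnerAges (PEv.step ∘ sh) G' *
              ((Real.exp (θ * Fb) * Real.exp (-credits (credit C (g K) ∘ sh) G')) * Xl)) := by ring
        _ ≤ Δ * (Λ' ^ partnerAges (PEv.step ∘ sh) G' * (Real.exp (-credits (credit C' (g K) ∘ sh) G') * Xl)) := by
            gcongr
  exact relWeightBound_lateMergers_of_irThreshold sh h' hμ₀ Cell hV hΛ hcell Dcap Ncap jstar hj hc hfrac D hΔ hA hA'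
    hCn R g β' h27 h29 hR hx1 hir' hP hηplus hr hΛ0 h1 hx y hy0 hlabTH str hinj hstr hF hF'

/-- **THE TH EXIT WITH THE ZONE-CROWDING BINDER `hlabZTH`, HORIZON `0`, THRESHOLD NAMED.**  As §2 at `D = 0` except:
zone constants `1 ≤ Kz`, `0 ≤ p`, `0 < σ < 1`, rates `0 < ε`, `0 < θ`, smallness at `irThresholdZTH sh C Kz p σ ε θ L r β₀`;
the placement rate is `Λ′e^{ε}` in the exit's two rate conditions (written out); the slot price may carry the (GM)
multiplicity `Kz^{#merges}·∏ Q(wcnt,σ,step)^p·Λ′^{partnerAges}` READ ON THE FLAT GENEALOGY `gmap sh G′` (row S6's form) for a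
consistent, fresh tagged `G′` with SHAPE-GENERIC events `Set.InjOn sh ↑G′.events` (displayed).  Proof: `hlabZTH ⇒ hlabGTH`
at `θ := zoneRate`, `Λ′ := Λ′e^{ε}` by `zone_surcharge_le` on `gmap sh G′` (consistent by `consistent_relabel_iff`, well
formed by `wf_relabel_of_injOn`), `Finset.sum_image_le_of_nonneg` (flat births weigh at most the tagged ones) and
`partnerAges_relabel`. [folklore] -/
theorem relWeightBound_lateMergersZ_of_irThreshold (sh : ε → PEv) {C : T4PrintedShapeBanking.Consts} {L r : ℕ}
    {β₀ : ℝ} (h : ThresholdOK C L r β₀) (hμ₀ : 0 < C.μ)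
    {Kz p σ ε' θ : ℝ} (hKz : 1 ≤ Kz) (hp : 0 ≤ p) (h0 : 0 < σ) (h1σ : σ < 1) (hε : 0 < ε') (hθ : 0 < θ)
    (Cell : ℕ → ℕ → Finset γ) {V Λ : ℝ} (hV : 0 ≤ V) (hΛ : 0 < Λ)
    (hcell : ∀ K a, ((Cell K a).card : ℝ) ≤ V * Λ ^ a) (Dcap Ncap : ℕ → ℕ)
    (jstar : ℕ → ℕ) (hj : ∀ K, jstar K ≤ K) {c : ℝ} (hc : 0 < c)
    (hfrac : ∀ K : ℕ, c * K ≤ ((K - jstar K : ℕ) : ℝ)) {Δ : ℝ} (hΔ : 1 ≤ Δ)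
    (hA : Regeneration l₀ π T A Bad' dead F Rf nlow nup Cn K₀)
    (hA' : Regeneration l₀ π T A' Bad' dead' F' Rf' mlow mup Cn K₀) (hCn : 0 ≤ Cn)
    (R : ℕ → ℕ → ℕ) (g : ℕ → ℕ → ℝ) (β' : ℕ → ℝ)
    (h27 : ∀ K, K₀ ≤ K → B14.FlowIneq27 (g K) (β' K) β₀ C.p₀ K)
    (h29 : ∀ K, K₀ ≤ K → B14FlowStep.FlowIneq29 (R K) (g K) L (β' K) β₀ K)
    (hR : ∀ K, K₀ ≤ K → ∀ s, s ≤ K → B14.IsRj L r (g K s) (R K s))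
    (hx1 : ∀ K, K₀ ≤ K → ∀ s, s ≤ K → 1 ≤ Real.log ((g K s) ^ 2)⁻¹)
    (hir : ∀ K, K₀ ≤ K → irThresholdZTH sh C Kz p σ ε' θ L r β₀ ≤ Real.log ((g K K) ^ 2)⁻¹)
    (hP : ∀ K s, 0 ≤ p0Profile C.A₀ C.p₀ (g K s))
    {ηplus : ℝ} (hηplus : 0 ≤ ηplus) (hr : Λ * Real.exp (ηplus - C.κ₁) < 1)
    {Λ' : ℝ} (hΛ0 : 0 ≤ Λ') (h1 : Λ' * Real.exp ε' * Real.exp (-C.κ₁) * Real.exp ηplus < 1)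
    (hx : (Real.exp (-C.E₀) + Real.exp (-C.E₀) * birthMass C *
          (Λ' * Real.exp ε' * Real.exp (-C.κ₁) / (1 - Λ' * Real.exp ε' * Real.exp (-C.κ₁) * Real.exp ηplus))) *
          Real.exp ηplus ≤
        Real.exp ηplus - 1)
    (y : ℕ → ℕ → γ → Gen PEv → ℝ)
    (hy0 : ∀ K, ∀ j ≤ K, ∀ z ∈ Cell K (K - j), ∀ G ∈ canonFam Dcap Ncap K j, 0 ≤ y K j z G)
    (hlabZTH : ∀ K, K₀ ≤ K → ∀ j ≤ K, ∀ z ∈ Cell K (K - j), ∀ G ∈ canonFam Dcap Ncap K j,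
      y K j z G ≤ 0 ∨ ∃ G' : Gen ε, ConsistentT sh C K (R K) G' ∧ FreshT G' ∧ Set.InjOn sh ↑G'.events ∧
        K < G'.reach (dictWT sh (R K) C.n₁) ∧ relabel (shape ∘ sh) G' = G ∧
        y K j z G ≤ Δ * (Kz ^ (merges (gmap sh G')).card *
          (∏ e ∈ merges (gmap sh G'), Crowding.Q (wcnt (gmap sh G')) σ e.step ^ p) *
          Λ' ^ partnerAges PEv.step (gmap sh G') * (Real.exp (-credits (credit C (g K) ∘ sh) G') *
            Real.exp (lifeCost (padW (dictWT sh (R K) C.n₁) 0) (costT sh C K (R K)) G'))))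
    (str : ℕ → κ → Finset (BSlot γ PEv))
    (hinj : ∀ K t, |t| ≤ l₀ → K₀ ≤ K → Set.InjOn (str K) (Bad' K t))
    (hstr : ∀ K t, |t| ≤ l₀ → K₀ ≤ K → ∀ c ∈ Bad' K t,
      str K c ⊆ bliveSlots Cell (canonFam Dcap Ncap) K ∧
        ∃ o ∈ boldSlots Cell (canonFam Dcap Ncap) jstar K, o ∈ str K c)
    (hF : ∀ K t, |t| ≤ l₀ → K₀ ≤ K → ∀ c ∈ Bad' K t, F K c * Rf K c ≤ famWeight (bslotPrice (y K)) (str K c))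
    (hF' : ∀ K t, |t| ≤ l₀ → K₀ ≤ K → ∀ c ∈ Bad' K t, F' K c * Rf' K c ≤ famWeight (bslotPrice (y K)) (str K c)) :
    ∃ K₁, K₀ ≤ K₁ ∧ RelWeightBound l₀ T A A' (fun K t => if K₁ ≤ K then badOfClass π T Bad' K t else ∅)
      (Set.indicator {K | K₁ ≤ K}
        (fun K => Cn * recordsBudget (Δ * Real.exp (C.κ₁ * ((0 : ℕ) : ℝ)) * birthMass C) C.κ₁ V Λ ηplus jstar K)) := by
  have hθz : 0 ≤ zoneRate Kz p σ ε' θ := zoneRate_nonneg hKz hp h0 h1σ hθ.le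
  have hΛ0' : 0 ≤ Λ' * Real.exp ε' := mul_nonneg hΛ0 (Real.exp_pos ε').le
  have hΔ0 : 0 ≤ Δ := zero_le_one.trans hΔ
  have hlabGTH : ∀ K, K₀ ≤ K → ∀ j ≤ K, ∀ z ∈ Cell K (K - j), ∀ G ∈ canonFam Dcap Ncap K j,
      y K j z G ≤ 0 ∨ ∃ G' : Gen ε, ConsistentTH sh C K (R K) 0 G' ∧ FreshT G' ∧
        K - 0 < G'.reach (dictWT sh (R K) C.n₁) ∧ relabel (shape ∘ sh) G' = G ∧
        y K j z G ≤ Δ * (Real.exp (zoneRate Kz p σ ε' θ * ∑ b ∈ births G', ((((sh b).fat : ℕ) : ℝ) + 1)) *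
          ((Λ' * Real.exp ε') ^ partnerAges (PEv.step ∘ sh) G' * (Real.exp (-credits (credit C (g K) ∘ sh) G') *
            Real.exp (lifeCost (padW (dictWT sh (R K) C.n₁) 0) (costT sh C K (R K)) G')))) := by
    intro K hK j hjK z hz G hG
    rcases hlabZTH K hK j hjK z hz G hG with h0' | ⟨G', hcT, hfG, hinjG, hKr, hsh, hy⟩
    · exact Or.inl h0'
    · refine Or.inr ⟨G', consistentTH_zero_iff.2 hcT, hfG, by simpa using hKr, hsh, hy.trans ?_⟩
      -- the flat genealogy `gmap sh G'` is consistent and well formed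
      have hcF : Consistent C K (R K) (gmap sh G') := by
        rw [← relabel_eq_gmap]; exact (consistent_relabel_iff sh C K (R K) G').2 hcT
      have hWF : (gmap sh G').WF (dictW (R K) C.n₁) := by
        rw [← relabel_eq_gmap]
        exact wf_relabel_of_injOn sh (dictW (R K) C.n₁) (wf_of_consistentT_freshT hcT hfG) hinjG
      -- the zone surcharge is class-linear on the flat genealogy
      have key := zone_surcharge_le (dictW (R K) C.n₁) hKz hp h0 h1σ hε hθ hΛ0 hcF hWF
      -- flat births weigh at most the tagged ones; partner ages are equal
      have hF : ∑ b ∈ births (gmap sh G'), ((b.fat : ℝ) + 1) ≤ ∑ b ∈ births G', ((((sh b).fat : ℕ) : ℝ) + 1) := by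
        rw [births_gmap]
        exact sum_image_le_of_nonneg fun _ _ => by positivity
      have hages : partnerAges PEv.step (gmap sh G') = partnerAges (PEv.step ∘ sh) G' := by
        rw [← relabel_eq_gmap]; exact partnerAges_relabel sh (fun _ => rfl) G'
      have hexp : Real.exp (zoneRate Kz p σ ε' θ * ∑ b ∈ births (gmap sh G'), ((b.fat : ℝ) + 1)) ≤
          Real.exp (zoneRate Kz p σ ε' θ * ∑ b ∈ births G', ((((sh b).fat : ℕ) : ℝ) + 1)) :=
        Real.exp_le_exp.2 (mul_le_mul_of_nonneg_left hF hθz)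
      have hΛp : 0 ≤ (Λ' * Real.exp ε') ^ partnerAges (PEv.step ∘ sh) G' := pow_nonneg hΛ0' _
      rw [hages] at key ⊢
      set Xr := Real.exp (-credits (credit C (g K) ∘ sh) G') *
        Real.exp (lifeCost (padW (dictWT sh (R K) C.n₁) 0) (costT sh C K (R K)) G')
      set M := Kz ^ (merges (gmap sh G')).card * (∏ e ∈ merges (gmap sh G'), Crowding.Q (wcnt (gmap sh G')) σ e.step ^ p)
      have hM := key.trans (mul_le_mul_of_nonneg_right hexp hΛp)
      calc Δ * (M * Λ' ^ partnerAges (PEv.step ∘ sh) G' * Xr)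
          = Δ * ((M * Λ' ^ partnerAges (PEv.step ∘ sh) G') * Xr) := by ring
        _ ≤ Δ * ((Real.exp (zoneRate Kz p σ ε' θ * ∑ b ∈ births G', ((((sh b).fat : ℕ) : ℝ) + 1)) *
              (Λ' * Real.exp ε') ^ partnerAges (PEv.step ∘ sh) G') * Xr) := by gcongr
        _ = _ := by ring
  exact relWeightBound_lateMergersG_of_irThreshold sh h hμ₀ hθz Cell hV hΛ hcell Dcap Ncap jstar hj hc hfrac 0 hΔ hA
    hA' hCn R g β' h27 h29 hR hx1 hir hP hηplus hr hΛ0' (by simpa [mul_assoc] using h1)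
    (by simpa [mul_assoc] using hx) y hy0 hlabGTH str hinj hstr hF hF'

end EndToEnd
/-! ## §4 Sanity -/
namespace Sanity

/-- the zone TH threshold is the class-linear one at the zone rate and horizon `0` (by `rfl`), and both named thresholds
are at least `1` [folklore] -/
example {ε : Type*} [DecidableEq ε] (sh : ε → PEv) (C : T4PrintedShapeBanking.Consts) (Kz p σ ε' θ : ℝ)
    (L r : ℕ) (β₀ : ℝ) :
    irThresholdZTH sh C Kz p σ ε' θ L r β₀ = irThresholdGTH sh C (zoneRate Kz p σ ε' θ) L r β₀ 0 ∧
      1 ≤ irThresholdZTH sh C Kz p σ ε' θ L r β₀ :=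
  ⟨rfl, one_le_irThresholdGTH sh C _ L r β₀ 0⟩

end Sanity

end

end Summit.QuantumFields.BalabanUV.T4Continuum.HistoryZoneSurcharge
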